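import Mathlib.Analysis.Normed.Lp.lpSpace
import Mathlib.Topology.MetricSpace.Contracting
import Mathlib.Analysis.Calculus.UniformLimitsDeriv
import Literature.Analysis.FluidPDE.ForcedHeatDuhamelTime
import HarnessLib

/-!
# Mild solutions of semilinear heat systems `∂ₜu = Δu + f(x, u, ∂u)` with bounded `C¹` data:
# short-time existence by contraction, and translation invariance

Analysis/PDE support file (everything proved; no definitions, no named facts). First step of the
local well-posedness theory of semilinear heat systems on the whole space in the elementary
heat-semigroup form of the tree (`UnboundedOperators.heatExtension f t = e^{tΔ}f`, the slice
Duhamel integral `∫₀ᵗ e^{(t−s)Δ}g(s) ds` of `HeatDuhamelSliceRegularity.lean`): Taylor, *PDE III*,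
Ch. 15, §1, Prop. 1.1 — the integral equation

  `u(t) = e^{tΔ}u₀ + ∫₀ᵗ e^{(t−s)Δ} f(·, u(s), ∂u(s)) ds`

is solved by the contraction mapping principle in a ball of `C([0,T]; C¹_b)`, for `T` small in
terms of the `C¹` bound of `u₀` and of the local sup and Lipschitz bounds of `f`; here the ball is
taken in the Banach space `ℓ^∞(ℝ × E; V × (E →L V))` of bounded pairs `(u, ∂u)` (Mathlib `lp`),
intersected with the closed set of jointly measurable pairs whose slices are `C¹` graphs
`q = ∂u` (closed by `hasFDerivAt_of_tendstoUniformly`), so that no time regularity is needed at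
this stage — it is recovered later from the equation.

* `stronglyMeasurable_duhamel`, `stronglyMeasurable_fderiv_duhamel` — joint measurability of the
  Duhamel integral of a jointly measurable family and of its gradient;
* `continuous_fderiv_duhamel` — continuity in `x` of the gradient of the Duhamel integral of
  bounded continuous slices (dominated convergence);
* `duhamel_sub_apply`, `fderiv_duhamel_sub_apply` — linearity in the data, for the Lipschitz
  estimate of the Picard map;
* `exists_mild_solution` — **short-time existence of a mild solution** with `u(t) ∈ C¹`,
  `‖u(t)‖, ‖∂u(t)‖ ≤ R`, jointly measurable, `u(0) = u₀`, and **invariance under every common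
  period of `f` and `u₀`** (uniqueness of the fixed point and translation covariance of `e^{tΔ}`).

## References

* M. E. Taylor, *Partial Differential Equations III. Nonlinear Equations*, 2nd ed., Springer
  (2011), Ch. 15, §1, Prop. 1.1 (local existence for semilinear parabolic equations by the
  contraction mapping principle on the integral equation). [TaylorPDEIII2011]
* L. C. Evans, *Partial Differential Equations*, 2nd ed., AMS (2010), §2.3.1 (Duhamel), §9.2.1
  (Banach's fixed point method). [Evans2010]
-/

noncomputable section

open MeasureTheory Set Function Filter Metric Real
open _root_.Topology
open scoped ENNReal NNReal ContDiff

namespace Literature.Analysis.PDE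

namespace SemilinearHeat

open Literature.Analysis.UnboundedOperators Literature.Analysis.UnboundedOperators.HeatHolder
open Literature.Analysis.FluidPDE

-- nested operator types `E →L[ℝ] E →L[ℝ] V`
set_option maxSynthPendingDepth 3

variable {E : Type*} [NormedAddCommGroup E] [InnerProductSpace ℝ E] [FiniteDimensional ℝ E]
  [MeasurableSpace E] [BorelSpace E]
variable {F : Type*} [NormedAddCommGroup F] [NormedSpace ℝ F] [CompleteSpace F]

/-! ### Measurability of the Duhamel integral in `(t, x)` -/

section Measurability

omit [CompleteSpace F] in
/-- **Caloric lifts of a measurable family, with a measurable time change, are jointly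
measurable** (parameter space `α`; the tree's `stronglyMeasurable_heatExtension_slice` is the
case `α = ℝ`). [folklore] -/
theorem stronglyMeasurable_heatExtension_param {α : Type*} [MeasurableSpace α] {G : α → E → F}
    (hG : StronglyMeasurable (uncurry G)) {τ : α → ℝ} (hτ : Measurable τ) :
    StronglyMeasurable fun p : α × E => heatExtension (G p.1) (τ p.1) p.2 := by
  have hK : Measurable (fun q : ℝ × E => heatKernel q.1 q.2) := by
    unfold heatKernel
    fun_prop
  have hF : StronglyMeasurable fun r : (α × E) × E => heatKernel (τ r.1.1) r.2 • G r.1.1 (r.1.2 - r.2) := by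
    have g1 : Measurable fun r : (α × E) × E => ((τ r.1.1, r.2) : ℝ × E) :=
      (hτ.comp measurable_fst.fst).prodMk measurable_snd
    have g2 : Measurable fun r : (α × E) × E => ((r.1.1, r.1.2 - r.2) : α × E) :=
      measurable_fst.fst.prodMk (measurable_fst.snd.sub measurable_snd)
    exact ((hK.comp g1).stronglyMeasurable).smul (hG.comp_measurable g2)
  have key : StronglyMeasurable fun p : α × E => ∫ y, heatKernel (τ p.1) y • G p.1 (p.2 - y) :=
    hF.integral_prod_right' (ν := (volume : Measure E))
  have hfun : (fun p : α × E => heatExtension (G p.1) (τ p.1) p.2) =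
      fun p => ∫ y, heatKernel (τ p.1) y • G p.1 (p.2 - y) := by
    funext p; exact heatExtension_apply _ _ _
  rw [hfun]; exact key

omit [CompleteSpace F] in
/-- **The Duhamel integral of a jointly measurable family is jointly measurable in `(t, x)`**
(Fubini measurability of `∫ 1_{(0,t)}(s) e^{(t−s)Δ}g(s)(x) ds`). [folklore] -/
theorem stronglyMeasurable_duhamel {g : ℝ → E → F} (hgm : StronglyMeasurable (uncurry g)) :
    StronglyMeasurable fun p : ℝ × E => ∫ s in Ioo 0 p.1, heatExtension (g s) (p.1 - s) p.2 := by
  classical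
  -- the lifts as a function of `((t, s), x)`
  have h1 : StronglyMeasurable fun r : (ℝ × ℝ) × E => heatExtension (g r.1.2) (r.1.1 - r.1.2) r.2 := by
    have hG : StronglyMeasurable (uncurry fun (a : ℝ × ℝ) (y : E) => g a.2 y) :=
      hgm.comp_measurable (measurable_fst.snd.prodMk measurable_snd)
    exact stronglyMeasurable_heatExtension_param (α := ℝ × ℝ) (G := fun a y => g a.2 y)
      (τ := fun a => a.1 - a.2) hG (measurable_fst.sub measurable_snd)
  -- as a function of `((t, x), s)`
  have hre : Measurable fun q : (ℝ × E) × ℝ => (((q.1.1, q.2), q.1.2) : (ℝ × ℝ) × E) :=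
    (measurable_fst.fst.prodMk measurable_snd).prodMk measurable_fst.snd
  have h2 : StronglyMeasurable ((fun r : (ℝ × ℝ) × E => heatExtension (g r.1.2) (r.1.1 - r.1.2) r.2) ∘
      fun q : (ℝ × E) × ℝ => (((q.1.1, q.2), q.1.2) : (ℝ × ℝ) × E)) :=
    h1.comp_measurable hre
  have hS : MeasurableSet {q : (ℝ × E) × ℝ | q.2 ∈ Ioo 0 q.1.1} := by
    have : {q : (ℝ × E) × ℝ | q.2 ∈ Ioo 0 q.1.1} = {q | 0 < q.2} ∩ {q | q.2 < q.1.1} := by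
      ext q; simp [mem_Ioo]
    rw [this]
    exact (measurableSet_lt measurable_const measurable_snd).inter
      (measurableSet_lt measurable_snd measurable_fst.fst)
  have h3 : StronglyMeasurable fun q : (ℝ × E) × ℝ =>
      if q.2 ∈ Ioo 0 q.1.1 then heatExtension (g q.2) (q.1.1 - q.2) q.1.2 else 0 :=
    StronglyMeasurable.piecewise hS h2 stronglyMeasurable_const
  have h4 : StronglyMeasurable fun p : ℝ × E =>
      ∫ s, (if s ∈ Ioo 0 p.1 then heatExtension (g s) (p.1 - s) p.2 else 0) :=
    h3.integral_prod_right' (ν := (volume : Measure ℝ))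
  have hfun : (fun p : ℝ × E => ∫ s in Ioo 0 p.1, heatExtension (g s) (p.1 - s) p.2) =
      fun p : ℝ × E => ∫ s, (if s ∈ Ioo 0 p.1 then heatExtension (g s) (p.1 - s) p.2 else 0) := by
    funext p
    rw [← integral_indicator measurableSet_Ioo]
    exact integral_congr_ae (Eventually.of_forall fun s => by rw [indicator_apply])
  rw [hfun]
  exact h4

/-- **The gradient of the Duhamel integral is jointly measurable in `(t, x)`** (bounded continuous
slices: every slice `x ↦ J[g](t, x)` is differentiable, and derivative fields of measurable
families of differentiable slices are measurable). [folklore] -/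
theorem stronglyMeasurable_fderiv_duhamel {g : ℝ → E → F} {C : ℝ}
    (hgm : StronglyMeasurable (uncurry g)) (hgc : ∀ s, Continuous (g s)) (hgC : ∀ s y, ‖g s y‖ ≤ C) :
    StronglyMeasurable fun p : ℝ × E =>
      fderiv ℝ (fun x => ∫ s in Ioo 0 p.1, heatExtension (g s) (p.1 - s) x) p.2 := by
  have hJ := stronglyMeasurable_duhamel hgm
  have hd : ∀ t, Differentiable ℝ (fun x => ∫ s in Ioo 0 t, heatExtension (g s) (t - s) x) :=
    fun t x => (hasFDerivAt_duhamel hgm hgc hgC t x).differentiableAt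
  exact stronglyMeasurable_fderiv_family (g := fun t x => ∫ s in Ioo 0 t, heatExtension (g s) (t - s) x)
    hJ hd

/-- **Continuity in `x` of the gradient of the Duhamel integral** of bounded continuous slices
(dominated convergence: the integrand `D(e^{(t−s)Δ}g(s))(x)` is continuous in `x` and dominated
by `c(t−s)^{-1/2}C`). [folklore] -/
theorem continuous_fderiv_duhamel {g : ℝ → E → F} {C : ℝ}
    (hgm : StronglyMeasurable (uncurry g)) (hgc : ∀ s, Continuous (g s)) (hgC : ∀ s y, ‖g s y‖ ≤ C)
    (t : ℝ) :
    Continuous fun x => fderiv ℝ (fun x => ∫ s in Ioo 0 t, heatExtension (g s) (t - s) x) x := by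
  set c : ℝ := (2 : ℝ) ^ ((Module.finrank ℝ E : ℝ) / 2) with hc
  have hfun : (fun x => fderiv ℝ (fun x => ∫ s in Ioo 0 t, heatExtension (g s) (t - s) x) x) =
      fun x => ∫ s in Ioo 0 t, fderiv ℝ (heatExtension (g s) (t - s)) x :=
    funext fun x => (hasFDerivAt_duhamel hgm hgc hgC t x).fderiv
  rw [hfun]
  refine continuous_of_dominated (μ := volume.restrict (Ioo 0 t))
    (F := fun x s => fderiv ℝ (heatExtension (g s) (t - s)) x)
    (bound := fun s => c * (t - s) ^ (-(1 / 2 : ℝ)) * C) ?_ ?_ ?_ ?_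
  · exact fun x => aestronglyMeasurable_fderiv_lift_apply hgm hgc hgC t x
  · intro x
    filter_upwards [ae_restrict_mem measurableSet_Ioo] with s hs
    exact norm_fderiv_heatExtension_le_of_bounded (hgc s).aestronglyMeasurable (hgC s) (sub_pos.2 hs.2) x
  · exact ((integrableOn_rpow_sub (r := -(1 / 2 : ℝ)) (by norm_num) 0 t).const_mul c).mul_const C
  · filter_upwards [ae_restrict_mem measurableSet_Ioo] with s hs
    exact (contDiff_lift hgc hgC (m := 1) hs.2).continuous_fderiv one_ne_zero

end Measurability

/-! ### Linearity in the data and translation covariance -/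

section Linearity

variable {g₁ g₂ : ℝ → E → F} {C₁ C₂ : ℝ}

omit [CompleteSpace F] in
/-- The Duhamel integral is linear in bounded continuous data:
`J[g₁](t,x) − J[g₂](t,x) = J[g₁ − g₂](t,x)`. [folklore] -/
theorem duhamel_sub_apply (hg₁m : StronglyMeasurable (uncurry g₁)) (hg₂m : StronglyMeasurable (uncurry g₂))
    (hg₁c : ∀ s, Continuous (g₁ s)) (hg₂c : ∀ s, Continuous (g₂ s))
    (hC₁ : ∀ s y, ‖g₁ s y‖ ≤ C₁) (hC₂ : ∀ s y, ‖g₂ s y‖ ≤ C₂) (t : ℝ) (x : E) :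
    (∫ s in Ioo 0 t, heatExtension (g₁ s) (t - s) x) - ∫ s in Ioo 0 t, heatExtension (g₂ s) (t - s) x =
      ∫ s in Ioo 0 t, heatExtension (fun y => g₁ s y - g₂ s y) (t - s) x := by
  rw [← integral_sub (integrableOn_lift_apply hg₁m hC₁ t x) (integrableOn_lift_apply hg₂m hC₂ t x)]
  refine setIntegral_congr_fun measurableSet_Ioo fun s hs => ?_
  exact (heatExtension_sub_of_bound (hg₁c s) (hg₂c s) (hC₁ s) (hC₂ s) (sub_pos.2 hs.2) x).symm

/-- The gradient of the Duhamel integral is linear in bounded continuous data. [folklore] -/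
theorem fderiv_duhamel_sub_apply (hg₁m : StronglyMeasurable (uncurry g₁))
    (hg₂m : StronglyMeasurable (uncurry g₂)) (hg₁c : ∀ s, Continuous (g₁ s)) (hg₂c : ∀ s, Continuous (g₂ s))
    (hC₁ : ∀ s y, ‖g₁ s y‖ ≤ C₁) (hC₂ : ∀ s y, ‖g₂ s y‖ ≤ C₂) (t : ℝ) (x : E) :
    fderiv ℝ (fun x => ∫ s in Ioo 0 t, heatExtension (g₁ s) (t - s) x) x -
        fderiv ℝ (fun x => ∫ s in Ioo 0 t, heatExtension (g₂ s) (t - s) x) x =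
      fderiv ℝ (fun x => ∫ s in Ioo 0 t, heatExtension (fun y => g₁ s y - g₂ s y) (t - s) x) x := by
  have hfun : (fun x => ∫ s in Ioo 0 t, heatExtension (fun y => g₁ s y - g₂ s y) (t - s) x) =
      (fun x => ∫ s in Ioo 0 t, heatExtension (g₁ s) (t - s) x) -
        fun x => ∫ s in Ioo 0 t, heatExtension (g₂ s) (t - s) x := by
    funext x
    exact (duhamel_sub_apply hg₁m hg₂m hg₁c hg₂c hC₁ hC₂ t x).symm
  rw [hfun, fderiv_sub ((hasFDerivAt_duhamel hg₁m hg₁c hC₁ t x).differentiableAt)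
    ((hasFDerivAt_duhamel hg₂m hg₂c hC₂ t x).differentiableAt)]

omit [CompleteSpace F] in
/-- **Translation covariance of the heat extension**: `e^{tΔ}(h(· + v))(x) = e^{tΔ}h(x + v)`.
[folklore] -/
theorem heatExtension_comp_add_right (h : E → F) (v : E) (t : ℝ) (x : E) :
    heatExtension (fun y => h (y + v)) t x = heatExtension h t (x + v) := by
  rw [heatExtension_apply, heatExtension_apply]
  refine integral_congr_ae (Eventually.of_forall fun y => ?_)
  simp only [sub_add_eq_add_sub]

omit [CompleteSpace F] in
/-- Translation covariance of the Duhamel integral. [folklore] -/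
theorem duhamel_comp_add_right (g : ℝ → E → F) (v : E) (t : ℝ) (x : E) :
    (∫ s in Ioo 0 t, heatExtension (fun y => g s (y + v)) (t - s) x) =
      ∫ s in Ioo 0 t, heatExtension (g s) (t - s) (x + v) := by
  refine integral_congr_ae (Eventually.of_forall fun s => ?_)
  exact heatExtension_comp_add_right (g s) v (t - s) x

end Linearity

/-! ### The Picard map: estimates on the Duhamel term of a pair field -/

section Picard

variable {V : Type*} [NormedAddCommGroup V] [NormedSpace ℝ V]

/-- The nonlinearity along a jointly measurable pair field with continuous slices, bounded by
`R`, gives bounded continuous measurable data `g(s, y) = f(y, Φ(s, y))`. [folklore] -/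
theorem data_of_pairField {f : E × V × (E →L[ℝ] V) → V} (hfc : Continuous f) {R M : ℝ}
    (hfM : ∀ (x : E) (w : V × (E →L[ℝ] V)), ‖w‖ ≤ R → ‖f (x, w)‖ ≤ M)
    {Φ : ℝ × E → V × (E →L[ℝ] V)} (hΦm : StronglyMeasurable Φ) (hΦc : ∀ s, Continuous fun y => Φ (s, y))
    (hΦR : ∀ p, ‖Φ p‖ ≤ R) :
    StronglyMeasurable (uncurry fun s y => f (y, Φ (s, y))) ∧
      (∀ s, Continuous fun y => f (y, Φ (s, y))) ∧ ∀ s y, ‖f (y, Φ (s, y))‖ ≤ M := by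
  refine ⟨?_, fun s => hfc.comp (continuous_id.prodMk (hΦc s)), fun s y => hfM y _ (hΦR (s, y))⟩
  have h1 : StronglyMeasurable fun p : ℝ × E => ((p.2, Φ p) : E × V × (E →L[ℝ] V)) :=
    measurable_snd.stronglyMeasurable.prodMk hΦm
  exact hfc.comp_stronglyMeasurable h1

end Picard

/-! ### Short-time existence of a mild solution -/

section Existence

variable {V : Type*} [NormedAddCommGroup V] [NormedSpace ℝ V] [CompleteSpace V]

set_option maxHeartbeats 1600000 in
/-- **Short-time existence of a mild solution of `∂ₜu = Δu + f(x, u, ∂u)` for bounded `C¹`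
data, by the contraction mapping principle** (Taylor, *PDE III*, Ch. 15, §1, Prop. 1.1, in the
class `C([0,T]; C¹_b)`). Let `f` be continuous, bounded by `M` and `Lf`-Lipschitz in `(u, p)` on
`E × {‖(u, p)‖ ≤ R}`, and let `u₀ ∈ C¹` with `‖u₀‖, ‖∂u₀‖ ≤ A₀`, `A₀ + 1 ≤ R`. Then for an
explicit `T ∈ (0, 1]` there is `u : ℝ → E → V` with `u(0) = u₀` (and `u(t) = u₀` off `(0, T]`),
every slice `C¹` with `‖u(t)‖, ‖∂u(t)‖ ≤ R`, `u` and `∂u` jointly measurable, solving the integral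
equation `u(t) = e^{tΔ}u₀ + ∫₀ᵗ e^{(t−s)Δ}f(·, u(s), ∂u(s)) ds` for `t ∈ (0, T]`, and invariant
under every common period of `f` (in `x`) and `u₀` (uniqueness of the fixed point). The fixed
point is taken in the closed subset of `ℓ^∞(ℝ × E; V × (E →L V))` of measurable pairs `(u, q)`
with `C¹` slices `q = ∂u`, vanishing off `(0, T]`. [cite: TaylorPDEIII2011, Ch. 15 §1 Prop. 1.1] -/
theorem exists_mild_solution (f : E × V × (E →L[ℝ] V) → V) (hfc : Continuous f)
    {u₀ : E → V} {A₀ : ℝ} (hu₀ : IsCkBounded 1 A₀ u₀)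
    {R M Lf : ℝ} (hR : A₀ + 1 ≤ R) (hM : 0 ≤ M) (hLf : 0 ≤ Lf)
    (hfM : ∀ (x : E) (w : V × (E →L[ℝ] V)), ‖w‖ ≤ R → ‖f (x, w)‖ ≤ M)
    (hfL : ∀ (x : E) (w w' : V × (E →L[ℝ] V)), ‖w‖ ≤ R → ‖w'‖ ≤ R →
      ‖f (x, w) - f (x, w')‖ ≤ Lf * ‖w - w'‖)
    (P : Set E) (hfP : ∀ v ∈ P, ∀ (x : E) (w : V × (E →L[ℝ] V)), f (x + v, w) = f (x, w))
    (hu₀P : ∀ v ∈ P, ∀ x, u₀ (x + v) = u₀ x) :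
    ∃ T : ℝ, 0 < T ∧ T ≤ 1 ∧ ∃ u : ℝ → E → V,
      u 0 = u₀ ∧ (∀ t, t ∉ Ioc 0 T → u t = u₀) ∧
      (∀ t, ContDiff ℝ 1 (u t)) ∧
      (∀ t x, ‖u t x‖ ≤ R ∧ ‖fderiv ℝ (u t) x‖ ≤ R) ∧
      StronglyMeasurable (uncurry u) ∧
      StronglyMeasurable (fun p : ℝ × E => fderiv ℝ (u p.1) p.2) ∧
      (∀ t ∈ Ioc 0 T, ∀ x, u t x = heatExtension u₀ t x +
        ∫ s in Ioo 0 t, heatExtension (fun y => f (y, u s y, fderiv ℝ (u s) y)) (t - s) x) ∧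
      (∀ v ∈ P, ∀ t x, u t (x + v) = u t x) := by
  classical
  -- ### constants
  set c : ℝ := (2 : ℝ) ^ ((Module.finrank ℝ E : ℝ) / 2) with hc
  have hc1 : 1 ≤ c := Real.one_le_rpow (by norm_num) (by positivity)
  have hA₀ : 0 ≤ A₀ := hu₀.nonneg
  have hR0 : 0 ≤ R := by linarith
  set δ : ℝ := min (1 / (4 * c * (Lf + 1))) (1 / (2 * c * M + 1)) with hδ
  have hδ0 : 0 < δ := lt_min (by positivity) (by positivity)
  have hδ1 : δ ≤ 1 / (4 * c * (Lf + 1)) := min_le_left _ _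
  have hδ2 : δ ≤ 1 / (2 * c * M + 1) := min_le_right _ _
  have hδle : δ ≤ 1 := by
    refine hδ1.trans ?_
    rw [div_le_one (by positivity)]
    nlinarith
  set T : ℝ := δ ^ 2 with hT
  have hT0 : 0 < T := by positivity
  have hTδ : T ≤ δ := by rw [hT]; nlinarith
  have hT1 : T ≤ 1 := hTδ.trans hδle
  have hsqrtT : T ^ (1 / 2 : ℝ) = δ := by rw [hT, ← Real.sqrt_eq_rpow, Real.sqrt_sq hδ0.le]
  have hsqrt_le : ∀ {t : ℝ}, 0 < t → t ≤ T → t ^ (1 / 2 : ℝ) ≤ δ := fun ht htT => by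
    rw [← hsqrtT]; exact Real.rpow_le_rpow ht.le htT (by norm_num)
  -- smallness: sup bounds
  have hsmallM : 2 * c * M * δ ≤ 1 := by
    have h := mul_le_mul_of_nonneg_left hδ2 (by positivity : 0 ≤ 2 * c * M)
    rw [mul_one_div] at h
    exact h.trans ((div_le_one (by positivity)).2 (by linarith))
  have hsmallM' : M * δ ≤ 1 := by
    have : M * δ ≤ 2 * c * M * δ := by nlinarith [mul_nonneg hM hδ0.le]
    exact this.trans hsmallM
  -- smallness: Lipschitz bounds
  have hsmallL : 2 * c * Lf * δ ≤ 1 / 2 := by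
    have h := mul_le_mul_of_nonneg_left hδ1 (by positivity : 0 ≤ 2 * c * Lf)
    rw [mul_one_div] at h
    refine h.trans ?_
    rw [div_le_iff₀ (by positivity)]
    nlinarith
  have hsmallL' : Lf * δ ≤ 1 / 2 := by
    have : Lf * δ ≤ 2 * c * Lf * δ := by nlinarith [mul_nonneg hLf hδ0.le]
    exact this.trans hsmallL
  -- ### the free part
  have hfree : ∀ {t : ℝ}, 0 < t → IsCkBounded 1 A₀ (heatExtension u₀ t) := fun ht => hu₀.heatExtension ht
  have hfree_meas : StronglyMeasurable fun p : ℝ × E =>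
      if p.1 ∈ Ioc 0 T then heatExtension u₀ p.1 p.2 else 0 := by
    have h1 : StronglyMeasurable fun p : ℝ × E => heatExtension u₀ p.1 p.2 := by
      have hG : StronglyMeasurable (uncurry fun (_ : ℝ) (y : E) => u₀ y) :=
        (hu₀.contDiff.continuous.stronglyMeasurable).comp_measurable measurable_snd
      exact stronglyMeasurable_heatExtension_param (α := ℝ) (G := fun _ y => u₀ y) (τ := id) hG
        measurable_id
    exact h1.piecewise (measurable_fst measurableSet_Ioc) stronglyMeasurable_const
  have hfreeD_meas : StronglyMeasurable fun p : ℝ × E =>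
      if p.1 ∈ Ioc 0 T then fderiv ℝ (heatExtension u₀ p.1) p.2 else 0 := by
    have h1 : StronglyMeasurable fun p : ℝ × E => heatExtension (fderiv ℝ u₀) p.1 p.2 := by
      have hG : StronglyMeasurable (uncurry fun (_ : ℝ) (y : E) => fderiv ℝ u₀ y) :=
        ((hu₀.contDiff.continuous_fderiv one_ne_zero).stronglyMeasurable).comp_measurable measurable_snd
      exact stronglyMeasurable_heatExtension_param (α := ℝ) (G := fun _ y => fderiv ℝ u₀ y) (τ := id)
        hG measurable_id
    have h2 : StronglyMeasurable fun p : ℝ × E =>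
        if p.1 ∈ Ioc 0 T then heatExtension (fderiv ℝ u₀) p.1 p.2 else 0 :=
      h1.piecewise (measurable_fst measurableSet_Ioc) stronglyMeasurable_const
    have hfun : (fun p : ℝ × E => if p.1 ∈ Ioc 0 T then fderiv ℝ (heatExtension u₀ p.1) p.2 else 0) =
        fun p : ℝ × E => if p.1 ∈ Ioc 0 T then heatExtension (fderiv ℝ u₀) p.1 p.2 else 0 := by
      funext p
      split_ifs with hp
      · exact fderiv_heatExtension_of_bounded hu₀.contDiff hu₀.norm_apply_le hu₀.norm_fderiv_le hp.1 p.2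
      · rfl
    rw [hfun]
    exact h2
  -- ### the Picard map on pair fields
  set Pf : (ℝ × E → V × (E →L[ℝ] V)) → (ℝ × E → V × (E →L[ℝ] V)) := fun Φ p =>
    if p.1 ∈ Ioc 0 T then
      (heatExtension u₀ p.1 p.2 + ∫ s in Ioo 0 p.1, heatExtension (fun y => f (y, Φ (s, y))) (p.1 - s) p.2,
        fderiv ℝ (heatExtension u₀ p.1) p.2 +
          fderiv ℝ (fun x => ∫ s in Ioo 0 p.1, heatExtension (fun y => f (y, Φ (s, y))) (p.1 - s) x) p.2)
    else 0 with hPf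
  -- admissible pair fields (as plain functions)
  set Adm : (ℝ × E → V × (E →L[ℝ] V)) → Prop := fun Φ =>
    (∀ p, ‖Φ p‖ ≤ R) ∧ StronglyMeasurable Φ ∧ (∀ s, Continuous fun y => Φ (s, y)) ∧
      (∀ t ∈ Ioc 0 T, ∀ x, HasFDerivAt (fun y => (Φ (t, y)).1) ((Φ (t, x)).2) x) ∧
      ∀ p : ℝ × E, p.1 ∉ Ioc 0 T → Φ p = 0 with hAdm
  -- data along an admissible field
  have hdata : ∀ {Φ}, Adm Φ →
      StronglyMeasurable (uncurry fun s y => f (y, Φ (s, y))) ∧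
        (∀ s, Continuous fun y => f (y, Φ (s, y))) ∧ ∀ s y, ‖f (y, Φ (s, y))‖ ≤ M :=
    fun hΦ => data_of_pairField hfc hfM hΦ.2.1 hΦ.2.2.1 hΦ.1
  -- ### the Picard map preserves admissibility
  have hPf_adm : ∀ {Φ}, Adm Φ → Adm (Pf Φ) := by
    intro Φ hΦ
    obtain ⟨hgm, hgc, hgC⟩ := hdata hΦ
    -- the Duhamel term and its properties
    have hJd : ∀ t x, HasFDerivAt (fun x => ∫ s in Ioo 0 t, heatExtension (fun y => f (y, Φ (s, y))) (t - s) x)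
        (fderiv ℝ (fun x => ∫ s in Ioo 0 t, heatExtension (fun y => f (y, Φ (s, y))) (t - s) x) x) x :=
      fun t x => (hasFDerivAt_duhamel hgm hgc hgC t x).differentiableAt.hasFDerivAt
    have hJ0 : ∀ {t}, 0 < t → t ≤ T → ∀ x,
        ‖∫ s in Ioo 0 t, heatExtension (fun y => f (y, Φ (s, y))) (t - s) x‖ ≤ 1 := by
      intro t ht htT x
      calc _ ≤ M * t := norm_duhamel_le hgC ht.le x
        _ ≤ M * δ := by gcongr; exact htT.trans hTδ
        _ ≤ 1 := hsmallM'
    have hJ1 : ∀ {t}, 0 < t → t ≤ T → ∀ x,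
        ‖fderiv ℝ (fun x => ∫ s in Ioo 0 t, heatExtension (fun y => f (y, Φ (s, y))) (t - s) x) x‖ ≤ 1 := by
      intro t ht htT x
      calc _ ≤ 2 * c * M * t ^ (1 / 2 : ℝ) := norm_fderiv_duhamel_le hgm hgc hgC ht x
        _ ≤ 2 * c * M * δ := by gcongr; exact hsqrt_le ht htT
        _ ≤ 1 := hsmallM
    refine ⟨?_, ?_, ?_, ?_, ?_⟩
    · -- sup bound
      intro p
      by_cases hp : p.1 ∈ Ioc 0 T
      · simp only [hPf, hp, if_true]
        rw [Prod.norm_def]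
        refine max_le ?_ ?_
        · calc _ ≤ ‖heatExtension u₀ p.1 p.2‖ + ‖∫ s in Ioo 0 p.1, heatExtension (fun y => f (y, Φ (s, y))) (p.1 - s) p.2‖ :=
                norm_add_le _ _
            _ ≤ A₀ + 1 := add_le_add ((hfree hp.1).norm_apply_le p.2) (hJ0 hp.1 hp.2 p.2)
            _ ≤ R := hR
        · calc _ ≤ ‖fderiv ℝ (heatExtension u₀ p.1) p.2‖ +
                ‖fderiv ℝ (fun x => ∫ s in Ioo 0 p.1, heatExtension (fun y => f (y, Φ (s, y))) (p.1 - s) x) p.2‖ :=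
                norm_add_le _ _
            _ ≤ A₀ + 1 := add_le_add ((hfree hp.1).norm_fderiv_le p.2) (hJ1 hp.1 hp.2 p.2)
            _ ≤ R := hR
      · simp only [hPf, hp, if_false, norm_zero]
        exact hR0
    · -- measurability
      have hJm := stronglyMeasurable_duhamel hgm
      have hDJm := stronglyMeasurable_fderiv_duhamel hgm hgc hgC
      have h1 : StronglyMeasurable fun p : ℝ × E => heatExtension u₀ p.1 p.2 := by
        have hG : StronglyMeasurable (uncurry fun (_ : ℝ) (y : E) => u₀ y) :=
          (hu₀.contDiff.continuous.stronglyMeasurable).comp_measurable measurable_snd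
        exact stronglyMeasurable_heatExtension_param (α := ℝ) (G := fun _ y => u₀ y) (τ := id) hG
          measurable_id
      have hG₁ := h1.add hJm
      have hG₂ := hfreeD_meas.add hDJm
      have hfun : Pf Φ = {p : ℝ × E | p.1 ∈ Ioc 0 T}.piecewise
          (fun p => (heatExtension u₀ p.1 p.2 +
              ∫ s in Ioo 0 p.1, heatExtension (fun y => f (y, Φ (s, y))) (p.1 - s) p.2,
            (if p.1 ∈ Ioc 0 T then fderiv ℝ (heatExtension u₀ p.1) p.2 else 0) +
              fderiv ℝ (fun x => ∫ s in Ioo 0 p.1, heatExtension (fun y => f (y, Φ (s, y))) (p.1 - s) x) p.2))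
          (fun _ => 0) := by
        funext p
        by_cases hp : p.1 ∈ Ioc 0 T
        · rw [Set.piecewise_eq_of_mem _ _ _ (show p ∈ {p : ℝ × E | p.1 ∈ Ioc 0 T} from hp)]
          simp only [hPf, hp, if_true]
        · rw [Set.piecewise_eq_of_notMem _ _ _ (show p ∉ {p : ℝ × E | p.1 ∈ Ioc 0 T} from hp)]
          simp only [hPf, hp, if_false]
      rw [hfun]
      exact (hG₁.prodMk hG₂).piecewise (measurable_fst measurableSet_Ioc) stronglyMeasurable_const
    · -- slice continuity
      intro s
      by_cases hs : s ∈ Ioc 0 T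
      · have hfun : (fun y => Pf Φ (s, y)) = fun y =>
            (heatExtension u₀ s y + ∫ r in Ioo 0 s, heatExtension (fun y => f (y, Φ (r, y))) (s - r) y,
              fderiv ℝ (heatExtension u₀ s) y +
                fderiv ℝ (fun x => ∫ r in Ioo 0 s, heatExtension (fun y => f (y, Φ (r, y))) (s - r) x) y) := by
          funext y; simp only [hPf, hs, if_true]
        rw [hfun]
        have hJc : Continuous fun x => ∫ r in Ioo 0 s, heatExtension (fun y => f (y, Φ (r, y))) (s - r) x :=
          (show Differentiable ℝ _ from fun x => (hJd s x).differentiableAt).continuous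
        exact (((hfree hs.1).contDiff.continuous).add hJc).prodMk
          (((hfree hs.1).contDiff.continuous_fderiv one_ne_zero).add
            (continuous_fderiv_duhamel hgm hgc hgC s))
      · have hfun : (fun y => Pf Φ (s, y)) = fun _ => 0 := by
          funext y; simp only [hPf, hs, if_false]
        rw [hfun]
        exact continuous_const
    · -- the slices are `C¹` graphs
      intro t ht x
      have hfun : (fun y => (Pf Φ (t, y)).1) = fun y =>
          heatExtension u₀ t y + ∫ r in Ioo 0 t, heatExtension (fun y => f (y, Φ (r, y))) (t - r) y := by
        funext y; simp only [hPf, ht, if_true]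
      have hval : (Pf Φ (t, x)).2 = fderiv ℝ (heatExtension u₀ t) x +
          fderiv ℝ (fun x => ∫ r in Ioo 0 t, heatExtension (fun y => f (y, Φ (r, y))) (t - r) x) x := by
        simp only [hPf, ht, if_true]
      rw [hfun, hval]
      exact (((hfree ht.1).contDiff.differentiable one_ne_zero) x).hasFDerivAt.add (hJd t x)
    · -- vanishing off `(0, T]`
      intro p hp
      simp only [hPf, hp, if_false]
  -- ### the Picard map is a contraction on admissible fields
  have hPf_lip : ∀ {Φ Ψ}, Adm Φ → Adm Ψ → ∀ {D : ℝ}, 0 ≤ D → (∀ q, ‖Φ q - Ψ q‖ ≤ D) →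
      ∀ p, ‖Pf Φ p - Pf Ψ p‖ ≤ 1 / 2 * D := by
    intro Φ Ψ hΦ hΨ D hD hΦΨ p
    obtain ⟨hgm₁, hgc₁, hgC₁⟩ := hdata hΦ
    obtain ⟨hgm₂, hgc₂, hgC₂⟩ := hdata hΨ
    have hdiff : ∀ s y, ‖f (y, Φ (s, y)) - f (y, Ψ (s, y))‖ ≤ Lf * D := fun s y =>
      (hfL y _ _ (hΦ.1 _) (hΨ.1 _)).trans (mul_le_mul_of_nonneg_left (hΦΨ (s, y)) hLf)
    have hgm : StronglyMeasurable (uncurry fun s y => f (y, Φ (s, y)) - f (y, Ψ (s, y))) := hgm₁.sub hgm₂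
    have hgc : ∀ s, Continuous fun y => f (y, Φ (s, y)) - f (y, Ψ (s, y)) := fun s => (hgc₁ s).sub (hgc₂ s)
    by_cases hp : p.1 ∈ Ioc 0 T
    · have hpδ : p.1 ≤ δ := hp.2.trans hTδ
      simp only [hPf, hp, if_true, Prod.mk_sub_mk, add_sub_add_left_eq_sub]
      rw [Prod.norm_def]
      refine max_le ?_ ?_
      · rw [duhamel_sub_apply hgm₁ hgm₂ hgc₁ hgc₂ hgC₁ hgC₂]
        calc _ ≤ Lf * D * p.1 := norm_duhamel_le hdiff hp.1.le p.2
          _ ≤ Lf * D * δ := by gcongr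
          _ = (Lf * δ) * D := by ring
          _ ≤ 1 / 2 * D := mul_le_mul_of_nonneg_right hsmallL' hD
      · rw [fderiv_duhamel_sub_apply hgm₁ hgm₂ hgc₁ hgc₂ hgC₁ hgC₂]
        calc _ ≤ 2 * c * (Lf * D) * p.1 ^ (1 / 2 : ℝ) := norm_fderiv_duhamel_le hgm hgc hdiff hp.1 p.2
          _ ≤ 2 * c * (Lf * D) * δ := by gcongr; exact hsqrt_le hp.1 hp.2
          _ = (2 * c * Lf * δ) * D := by ring
          _ ≤ 1 / 2 * D := mul_le_mul_of_nonneg_right hsmallL hD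
    · simp only [hPf, hp, if_false, sub_zero, norm_zero]
      positivity
  -- ### the complete metric space of admissible pair fields in `ℓ^∞`
  set S : Set (lp (fun _ : ℝ × E => V × (E →L[ℝ] V)) ∞) := {Φ | Adm ⇑Φ} with hS
  have hmemS : ∀ {Φ : lp (fun _ : ℝ × E => V × (E →L[ℝ] V)) ∞}, Φ ∈ S ↔ Adm ⇑Φ := fun {Φ} => Iff.rfl
  have hPf_mem : ∀ Φ : lp (fun _ : ℝ × E => V × (E →L[ℝ] V)) ∞, Φ ∈ S → Memℓp (Pf ⇑Φ) ∞ := by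
    intro Φ hΦ
    refine memℓp_infty ⟨R, ?_⟩
    rintro _ ⟨p, rfl⟩
    exact (hPf_adm (hmemS.1 hΦ)).1 p
  let Pmap : lp (fun _ : ℝ × E => V × (E →L[ℝ] V)) ∞ → lp (fun _ : ℝ × E => V × (E →L[ℝ] V)) ∞ :=
    fun Φ => if h : Φ ∈ S then ⟨Pf ⇑Φ, hPf_mem Φ h⟩ else Φ
  have hPmap_coe : ∀ {Φ : lp (fun _ : ℝ × E => V × (E →L[ℝ] V)) ∞}, Φ ∈ S → ⇑(Pmap Φ) = Pf ⇑Φ := by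
    intro Φ hΦ
    simp only [Pmap, dif_pos hΦ]
  -- evaluation is `1`-Lipschitz
  have heval : ∀ (Φ Ψ : lp (fun _ : ℝ × E => V × (E →L[ℝ] V)) ∞) (q : ℝ × E), ‖Φ q - Ψ q‖ ≤ ‖Φ - Ψ‖ := by
    intro Φ Ψ q
    rw [← Pi.sub_apply, ← lp.coeFn_sub]
    exact lp.norm_apply_le_norm ENNReal.top_ne_zero _ q
  -- `S` is closed (uniform limits), hence complete
  have hSclosed : IsClosed S := by
    refine isSeqClosed_iff_isClosed.1 fun Φn Φ hΦn hlim => ?_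
    have hunif : TendstoUniformly (fun n p => Φn n p) (⇑Φ) atTop := by
      rw [Metric.tendstoUniformly_iff]
      intro ε hε
      have h := (tendsto_iff_norm_sub_tendsto_zero.1 hlim).eventually (gt_mem_nhds hε)
      filter_upwards [h] with n hn p
      rw [dist_eq_norm, ← norm_neg, neg_sub]
      exact (heval (Φn n) Φ p).trans_lt hn
    have hpt : ∀ p, Tendsto (fun n => Φn n p) atTop (𝓝 (Φ p)) := hunif.tendsto_at
    have hA : ∀ n, Adm ⇑(Φn n) := fun n => hmemS.1 (hΦn n)
    refine hmemS.2 ⟨?_, ?_, ?_, ?_, ?_⟩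
    · intro p
      exact le_of_tendsto ((continuous_norm.tendsto _).comp (hpt p)) (Eventually.of_forall fun n => (hA n).1 p)
    · exact stronglyMeasurable_of_tendsto atTop (fun n => (hA n).2.1) (tendsto_pi_nhds.2 hpt)
    · intro s
      have hu : TendstoUniformly (fun n y => Φn n (s, y)) (fun y => Φ (s, y)) atTop :=
        hunif.comp fun y => (s, y)
      exact hu.continuous (Eventually.of_forall fun n => (hA n).2.2.1 s).frequently
    · intro t ht x
      have hu : TendstoUniformly (fun n y => Φn n (t, y)) (fun y => Φ (t, y)) atTop :=
        hunif.comp fun y => (t, y)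
      have hu2 : TendstoUniformly (fun n y => (Φn n (t, y)).2) (fun y => (Φ (t, y)).2) atTop := by
        rw [Metric.tendstoUniformly_iff] at hu ⊢
        intro ε hε
        filter_upwards [hu ε hε] with n hn y
        refine lt_of_le_of_lt ?_ (hn y)
        rw [dist_eq_norm, dist_eq_norm, ← Prod.snd_sub]
        exact norm_snd_le _
      have hpt1 : ∀ y, Tendsto (fun n => (Φn n (t, y)).1) atTop (𝓝 (Φ (t, y)).1) :=
        fun y => (continuous_fst.tendsto _).comp (hpt (t, y))
      exact hasFDerivAt_of_tendstoUniformly hu2 (fun n y => (hA n).2.2.2.1 t ht y) hpt1 x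
    · intro p hp
      have h0 : (fun n => Φn n p) = fun _ => 0 := funext fun n => (hA n).2.2.2.2 p hp
      have h := hpt p
      rw [h0] at h
      exact tendsto_nhds_unique h tendsto_const_nhds
  have hScomplete : IsComplete S := hSclosed.isComplete
  -- the Picard map maps `S` to `S` and contracts by `1/2`
  have hmaps : MapsTo Pmap S S := by
    intro Φ hΦ
    refine hmemS.2 ?_
    rw [hPmap_coe hΦ]
    exact hPf_adm (hmemS.1 hΦ)
  have hlip : ∀ {Φ Ψ : lp (fun _ : ℝ × E => V × (E →L[ℝ] V)) ∞}, Φ ∈ S → Ψ ∈ S →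
      ‖Pmap Φ - Pmap Ψ‖ ≤ 1 / 2 * ‖Φ - Ψ‖ := by
    intro Φ Ψ hΦ hΨ
    refine lp.norm_le_of_forall_le (by positivity) fun p => ?_
    rw [lp.coeFn_sub, Pi.sub_apply, hPmap_coe hΦ, hPmap_coe hΨ]
    exact hPf_lip (hmemS.1 hΦ) (hmemS.1 hΨ) (norm_nonneg _) (heval Φ Ψ) p
  have hcontr : ContractingWith ((1 : ℝ≥0) / 2) (hmaps.restrict Pmap S S) := by
    refine ⟨by rw [div_lt_one (by norm_num)]; norm_num, LipschitzWith.of_dist_le_mul fun Φ Ψ => ?_⟩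
    rw [Subtype.dist_eq, MapsTo.val_restrict_apply, MapsTo.val_restrict_apply, Subtype.dist_eq,
      dist_eq_norm, dist_eq_norm]
    push_cast
    exact hlip Φ.2 Ψ.2
  have h0S : (0 : lp (fun _ : ℝ × E => V × (E →L[ℝ] V)) ∞) ∈ S := by
    refine hmemS.2 ?_
    rw [lp.coeFn_zero]
    refine ⟨?_, ?_, ?_, ?_, ?_⟩
    · intro p; simp [hR0]
    · exact stronglyMeasurable_const
    · intro s; exact continuous_const
    · intro t _ x
      exact hasFDerivAt_const (0 : V) x
    · intro p _; rfl
  -- ### the fixed point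
  obtain ⟨Φs, hΦsS, hfix, -⟩ :=
    ContractingWith.exists_fixedPoint' hScomplete hmaps hcontr h0S (edist_ne_top _ _)
  have hAs' : Adm ⇑Φs := hmemS.1 hΦsS
  -- hide the `ℓ^∞` coercion behind a plain function
  set Φf : ℝ × E → V × (E →L[ℝ] V) := ⇑Φs with hΦf
  have hAs : Adm Φf := hAs'
  have hPfix : Pf Φf = Φf := by
    have h : ⇑(Pmap Φs) = ⇑Φs := congrArg (fun Ψ : lp (fun _ : ℝ × E => V × (E →L[ℝ] V)) ∞ => (⇑Ψ : ℝ × E → _)) hfix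
    rw [hPmap_coe hΦsS] at h
    rw [hΦf]
    exact h
  -- uniqueness of fixed points in `S`
  have huniq : ∀ {Ψ : lp (fun _ : ℝ × E => V × (E →L[ℝ] V)) ∞}, Ψ ∈ S → Pmap Ψ = Ψ → Ψ = Φs := by
    intro Ψ hΨ hfixΨ
    have h := hcontr.2.dist_le_mul ⟨Ψ, hΨ⟩ ⟨Φs, hΦsS⟩
    rw [Subtype.dist_eq, MapsTo.val_restrict_apply, MapsTo.val_restrict_apply, Subtype.dist_eq] at h
    change dist (Pmap Ψ) (Pmap Φs) ≤ _ * dist Ψ Φs at h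
    rw [hfixΨ, show Pmap Φs = Φs from hfix] at h
    push_cast at h
    have hd : dist Ψ Φs = 0 := by
      have := dist_nonneg (x := Ψ) (y := Φs)
      nlinarith
    exact dist_eq_zero.1 hd
  -- ### invariance under the common periods
  have hperiod : ∀ v ∈ P, ∀ p : ℝ × E, Φf (p.1, p.2 + v) = Φf p := by
    intro v hv
    -- the translate of the fixed point
    have hmem : Memℓp (fun p : ℝ × E => Φf (p.1, p.2 + v)) ∞ := by
      refine memℓp_infty ⟨R, ?_⟩
      rintro _ ⟨p, rfl⟩
      exact hAs.1 _
    set Φv : lp (fun _ : ℝ × E => V × (E →L[ℝ] V)) ∞ := ⟨fun p : ℝ × E => Φf (p.1, p.2 + v), hmem⟩ with hΦv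
    have hcoev : (⇑Φv : ℝ × E → V × (E →L[ℝ] V)) = fun p => Φf (p.1, p.2 + v) := rfl
    have hAv : Adm (fun p : ℝ × E => Φf (p.1, p.2 + v)) := by
      refine ⟨fun p => hAs.1 _, ?_, ?_, ?_, ?_⟩
      · exact hAs.2.1.comp_measurable (measurable_fst.prodMk (measurable_snd.add_const v))
      · intro s
        exact (hAs.2.2.1 s).comp (continuous_id.add continuous_const)
      · intro t ht x
        exact (hasFDerivAt_comp_add_right (f := fun y => (Φf (t, y)).1) v).2 (hAs.2.2.2.1 t ht (x + v))
      · intro p hp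
        exact hAs.2.2.2.2 (p.1, p.2 + v) hp
    have hΦvS : Φv ∈ S := hmemS.2 (by rw [hcoev]; exact hAv)
    -- translation covariance of the Picard map
    have hu₀v : (fun y => u₀ (y + v)) = u₀ := funext fun y => hu₀P v hv y
    have hfreev : ∀ t x, heatExtension u₀ t (x + v) = heatExtension u₀ t x := by
      intro t x
      rw [← heatExtension_comp_add_right u₀ v t x, hu₀v]
    have hJv : ∀ t x, (∫ s in Ioo 0 t, heatExtension (fun y => f (y, Φf (s, y + v))) (t - s) x) =
        ∫ s in Ioo 0 t, heatExtension (fun y => f (y, Φf (s, y))) (t - s) (x + v) := by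
      intro t x
      have h1 : (∫ s in Ioo 0 t, heatExtension (fun y => f (y, Φf (s, y + v))) (t - s) x) =
          ∫ s in Ioo 0 t, heatExtension (fun y => f (y + v, Φf (s, y + v))) (t - s) x := by
        refine integral_congr_ae (Eventually.of_forall fun s => ?_)
        have hF : (fun y => f (y, Φf (s, y + v))) = fun y => f (y + v, Φf (s, y + v)) :=
          funext fun y => (hfP v hv y _).symm
        dsimp only
        rw [hF]
      rw [h1]
      exact duhamel_comp_add_right (fun s y => f (y, Φf (s, y))) v t x
    have hPfv : Pf (fun p : ℝ × E => Φf (p.1, p.2 + v)) = fun p => Pf Φf (p.1, p.2 + v) := by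
      funext p
      by_cases hp : p.1 ∈ Ioc 0 T
      · simp only [hPf, hp, if_true, Prod.mk.injEq]
        refine ⟨?_, ?_⟩
        · rw [hfreev, hJv]
        · congr 1
          · have hfun : heatExtension u₀ p.1 = fun x => heatExtension u₀ p.1 (x + v) :=
              funext fun x => (hfreev p.1 x).symm
            conv_lhs => rw [hfun]
            exact fderiv_comp_add_right v
          · have hfun : (fun x => ∫ s in Ioo 0 p.1, heatExtension (fun y => f (y, Φf (s, y + v))) (p.1 - s) x) =
                fun x => (fun x => ∫ s in Ioo 0 p.1, heatExtension (fun y => f (y, Φf (s, y))) (p.1 - s) x) (x + v) :=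
              funext fun x => hJv p.1 x
            rw [hfun]
            exact fderiv_comp_add_right (𝕜 := ℝ)
              (f := fun x => ∫ s in Ioo 0 p.1, heatExtension (fun y => f (y, Φf (s, y))) (p.1 - s) x) (x := p.2) v
      · simp only [hPf, hp, if_false]
    have hfixv : Pmap Φv = Φv := by
      apply lp.ext
      rw [hPmap_coe hΦvS, hcoev, hPfv]
      funext p
      exact congrFun hPfix (p.1, p.2 + v)
    have heq : Φv = Φs := huniq hΦvS hfixv
    intro p
    have h := congrArg (fun Ψ : lp (fun _ : ℝ × E => V × (E →L[ℝ] V)) ∞ => (⇑Ψ : ℝ × E → _) p) heq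
    dsimp only at h
    rw [← hΦf] at h
    exact h
  -- ### the solution
  have hslice : ∀ {t}, t ∈ Ioc 0 T → ∀ x, HasFDerivAt (fun y => (Φf (t, y)).1) ((Φf (t, x)).2) x :=
    fun ht x => hAs.2.2.2.1 _ ht x
  have hslice_fd : ∀ {t}, t ∈ Ioc 0 T → fderiv ℝ (fun y => (Φf (t, y)).1) = fun x => (Φf (t, x)).2 :=
    fun ht => funext fun x => (hslice ht x).fderiv
  have hslice_c1 : ∀ {t}, t ∈ Ioc 0 T → ContDiff ℝ 1 (fun y => (Φf (t, y)).1) := by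
    intro t ht
    rw [contDiff_one_iff_fderiv]
    refine ⟨fun x => (hslice ht x).differentiableAt, ?_⟩
    rw [hslice_fd ht]
    exact continuous_snd.comp (hAs.2.2.1 t)
  set u : ℝ → E → V := fun t x => if t ∈ Ioc 0 T then (Φf (t, x)).1 else u₀ x with hu
  have hu_in : ∀ {t}, t ∈ Ioc 0 T → u t = fun x => (Φf (t, x)).1 := fun ht => funext fun x => by
    simp only [hu, ht, if_true]
  have hu_out : ∀ {t}, t ∉ Ioc 0 T → u t = u₀ := fun ht => funext fun x => by
    simp only [hu, ht, if_false]
  have h0T : (0 : ℝ) ∉ Ioc 0 T := fun h => lt_irrefl _ h.1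
  have hfd_in : ∀ {t}, t ∈ Ioc 0 T → ∀ x, fderiv ℝ (u t) x = (Φf (t, x)).2 := fun ht x => by
    rw [hu_in ht, hslice_fd ht]
  refine ⟨T, hT0, hT1, u, hu_out h0T, fun t ht => hu_out ht, ?_, ?_, ?_, ?_, ?_, ?_⟩
  · -- `C¹` slices
    intro t
    by_cases ht : t ∈ Ioc 0 T
    · rw [hu_in ht]; exact hslice_c1 ht
    · rw [hu_out ht]; exact hu₀.contDiff
  · -- bounds
    intro t x
    by_cases ht : t ∈ Ioc 0 T
    · rw [hfd_in ht x, hu_in ht]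
      exact ⟨(norm_fst_le _).trans (hAs.1 _), (norm_snd_le _).trans (hAs.1 _)⟩
    · rw [hu_out ht]
      exact ⟨(hu₀.norm_apply_le x).trans (by linarith), (hu₀.norm_fderiv_le x).trans (by linarith)⟩
  · -- measurability of `u`
    have hfun : uncurry u = {p : ℝ × E | p.1 ∈ Ioc 0 T}.piecewise (fun p => (Φf p).1) fun p => u₀ p.2 := by
      funext p
      by_cases hp : p.1 ∈ Ioc 0 T
      · rw [Set.piecewise_eq_of_mem _ _ _ (show p ∈ {p : ℝ × E | p.1 ∈ Ioc 0 T} from hp)]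
        simp only [uncurry, hu, hp, if_true]
      · rw [Set.piecewise_eq_of_notMem _ _ _ (show p ∉ {p : ℝ × E | p.1 ∈ Ioc 0 T} from hp)]
        simp only [uncurry, hu, hp, if_false]
    rw [hfun]
    exact (continuous_fst.comp_stronglyMeasurable hAs.2.1).piecewise (measurable_fst measurableSet_Ioc)
      ((hu₀.contDiff.continuous.stronglyMeasurable).comp_measurable measurable_snd)
  · -- measurability of `∂u`
    have hfun : (fun p : ℝ × E => fderiv ℝ (u p.1) p.2) =
        {p : ℝ × E | p.1 ∈ Ioc 0 T}.piecewise (fun p => (Φf p).2) fun p => fderiv ℝ u₀ p.2 := by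
      funext p
      by_cases hp : p.1 ∈ Ioc 0 T
      · rw [Set.piecewise_eq_of_mem _ _ _ (show p ∈ {p : ℝ × E | p.1 ∈ Ioc 0 T} from hp)]
        exact hfd_in hp p.2
      · rw [Set.piecewise_eq_of_notMem _ _ _ (show p ∉ {p : ℝ × E | p.1 ∈ Ioc 0 T} from hp), hu_out hp]
    rw [hfun]
    exact (continuous_snd.comp_stronglyMeasurable hAs.2.1).piecewise (measurable_fst measurableSet_Ioc)
      (((hu₀.contDiff.continuous_fderiv one_ne_zero).stronglyMeasurable).comp_measurable measurable_snd)
  · -- the integral equation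
    intro t ht x
    have h := congrFun hPfix (t, x)
    have h1 : (Φf (t, x)).1 = heatExtension u₀ t x +
        ∫ s in Ioo 0 t, heatExtension (fun y => f (y, Φf (s, y))) (t - s) x := by
      rw [← h]
      simp only [hPf, ht, if_true]
    rw [hu_in ht]
    dsimp only
    rw [h1]
    congr 1
    refine setIntegral_congr_fun measurableSet_Ioo fun s hs => ?_
    have hs' : s ∈ Ioc 0 T := ⟨hs.1, hs.2.le.trans ht.2⟩
    have hF : (fun y => f (y, Φf (s, y))) = fun y => f (y, u s y, fderiv ℝ (u s) y) := by
      funext y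
      rw [hfd_in hs' y, hu_in hs']
    rw [hF]
  · -- invariance under the periods
    intro v hv t x
    by_cases ht : t ∈ Ioc 0 T
    · rw [hu_in ht]
      exact congrArg Prod.fst (hperiod v hv (t, x))
    · rw [hu_out ht]
      exact hu₀P v hv x

end Existence

end SemilinearHeat

end Literature.Analysis.PDE
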